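import Summits.Ventures.PercRepro.Classical
import Summits.Ventures.PercRepro.Partition

/-!
# PercRepro — the classical cone's (K2): BK for disjoint clusters of marked vertices (typer-2, gen 2)

The BK inequality (`BKInequality E`, a named hypothesis until proved in this directory) applied to
connection events of marked vertices. The disjoint witnesses are the edge sets of the open
clusters involved:

* `G.clusterEdges ω u` — the open edges of `ω` incident to the open cluster `C(u)`;
  `conn_restrictTo_clusterEdges`: every connection inside `C(u)` is already witnessed on these
  edges; `disjoint_clusterEdges`: the edge sets of two different clusters are disjoint.
* `K2_example_of_BK` — PLAN.md §1's example `P(a~b ∧ c~d ∧ a≁c) ≤ P(a~b) · P(c~d)` from BK.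
* `bkEvent m σ₁ σ₂` — PLAN.md §1's event `F(σ₁, σ₂)` (every block of `σ₁` and of `σ₂` lies in a
  block of `Π`, and no non-singleton block of `σ₁` shares a `Π`-block with a non-singleton block
  of `σ₂`); `K2_partition_of_BK`: `P(Π ∈ F(σ₁, σ₂)) ≤ P(σ₁ ≤ Π) · P(σ₂ ≤ Π)` from BK.
-/

namespace PercRepro

namespace MultiGraph

variable {V E : Type*} (G : MultiGraph V E)

section ClusterEdges

variable [Fintype E]

open Classical in
/-- The open edges of `ω` incident to the open cluster of `u`: the edge set on which every
connection inside `C(u)` is witnessed. -/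
noncomputable def clusterEdges (ω : Config E) (u : V) : Finset E :=
  Finset.univ.filter fun e => ω e = true ∧ G.Conn ω u (G.fst e)

/-- Membership in the cluster edge set. -/
lemma mem_clusterEdges {ω : Config E} {u : V} {e : E} :
    e ∈ G.clusterEdges ω u ↔ ω e = true ∧ G.Conn ω u (G.fst e) := by
  simp [clusterEdges]

/-- The edge sets of two different open clusters are disjoint. -/
lemma disjoint_clusterEdges {ω : Config E} {u v : V} (h : ¬ G.Conn ω u v) :
    Disjoint (G.clusterEdges ω u) (G.clusterEdges ω v) := by
  rw [Finset.disjoint_left]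
  intro e heu hev
  rw [G.mem_clusterEdges] at heu hev
  exact h (heu.2.trans hev.2.symm)

variable [DecidableEq E]

omit [Fintype E] in
/-- Restriction is monotone in the edge set. -/
lemma restrictTo_mono {K L : Finset E} (h : K ⊆ L) (ω : Config E) :
    restrictTo K ω ≤ restrictTo L ω := by
  intro e
  show (if e ∈ K then ω e else false) ≤ (if e ∈ L then ω e else false)
  by_cases he : e ∈ K
  · rw [if_pos he, if_pos (h he)]
  · rw [if_neg he]
    exact Bool.false_le _

/-- Inside the open cluster of `u`, connectivity is already witnessed by the edges of
`clusterEdges ω u`: if `u ↔ v` in `ω` then `u ↔ v` in the restriction of `ω` to these edges. -/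
lemma conn_restrictTo_clusterEdges {ω : Config E} {u v : V} (h : G.Conn ω u v) :
    G.Conn (restrictTo (G.clusterEdges ω u) ω) u v := by
  refine Conn.induction (motive := fun w => G.Conn (restrictTo (G.clusterEdges ω u) ω) u w)
    (Conn.refl G _ u) ?_ h
  intro a b hua hab ih
  obtain ⟨e, he, hend⟩ := hab
  have hfst : G.Conn ω u (G.fst e) := by
    rcases hend with ⟨h1, _⟩ | ⟨h1, h2⟩
    · rw [h1]
      exact hua
    · rw [h1]
      exact hua.trans (Conn.of_openAdj ⟨e, he, Or.inr ⟨h1, h2⟩⟩)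
  have hmem : e ∈ G.clusterEdges ω u := (G.mem_clusterEdges).2 ⟨he, hfst⟩
  have he' : restrictTo (G.clusterEdges ω u) ω e = true := by
    rw [restrictTo_agree _ _ hmem]
    exact he
  exact ih.trans (Conn.of_openAdj ⟨e, he', hend⟩)

/-- `{a ↔ b} ∩ {c ↔ d} ∩ {a ↮ c} ⊆ {a ↔ b} ◻ {c ↔ d}` (open-witness form): the witnesses are the
edge sets of the clusters of `a` and of `c`. -/
lemma connEvent_inter_connEvent_inter_sepEvent_subset (a b c d : V) :
    G.connEvent a b ∩ G.connEvent c d ∩ G.sepEvent a c ⊆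
      disjOccurRestrict (G.connEvent a b) (G.connEvent c d) := by
  rintro ω ⟨⟨hab, hcd⟩, hac⟩
  exact ⟨G.clusterEdges ω a, G.clusterEdges ω c, G.disjoint_clusterEdges hac,
    G.conn_restrictTo_clusterEdges hab, G.conn_restrictTo_clusterEdges hcd⟩

/-- **(K2), simplest instance** (PLAN.md §1): `P(a~b ∧ c~d ∧ a≁c) ≤ P(a~b) · P(c~d)`, from the BK
inequality. -/
theorem K2_example_of_BK (hBK : BKInequality E) {p : E → ℝ} (hp : IsProb p) (a b c d : V) :
    prob p (G.connEvent a b ∩ G.connEvent c d ∩ G.sepEvent a c) ≤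
      prob p (G.connEvent a b) * prob p (G.connEvent c d) :=
  (prob_mono hp (G.connEvent_inter_connEvent_inter_sepEvent_subset a b c d)).trans
    (BKInequality_iff_restrict.1 hBK p hp _ _ (G.isUpperSet_connEvent a b)
      (G.isUpperSet_connEvent c d))

end ClusterEdges

/-! ### (K2) in partition form -/

/-- `i` lies in a non-singleton block of the partition `σ`. -/
def InNontrivialBlock {k : ℕ} (σ : Setoid (Fin k)) (i : Fin k) : Prop := ∃ j, j ≠ i ∧ σ i j

/-- PLAN.md §1's event `F(σ₁, σ₂)`: every block of `σ₁` and every block of `σ₂` lies in a block of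
the random partition `Π` (`σ₁ ≤ Π`, `σ₂ ≤ Π`), and no non-singleton block of `σ₁` shares a
`Π`-block with a non-singleton block of `σ₂`. -/
def bkEvent {k : ℕ} (m : Fin k → V) (σ₁ σ₂ : Setoid (Fin k)) : Set (Config E) :=
  {ω | σ₁ ≤ G.markedPartition ω m ∧ σ₂ ≤ G.markedPartition ω m ∧
    ∀ i j, InNontrivialBlock σ₁ i → InNontrivialBlock σ₂ j → ¬ G.Conn ω (m i) (m j)}

section BlockEdges

variable [Fintype E]

open Classical in
/-- The open edges of the clusters of the marked vertices lying in non-singleton blocks of `σ`. -/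
noncomputable def blockEdges (ω : Config E) {k : ℕ} (m : Fin k → V) (σ : Setoid (Fin k)) :
    Finset E :=
  (Finset.univ.filter fun i => InNontrivialBlock σ i).biUnion fun i => G.clusterEdges ω (m i)

/-- Membership in the block edge set. -/
lemma mem_blockEdges {ω : Config E} {k : ℕ} {m : Fin k → V} {σ : Setoid (Fin k)} {e : E} :
    e ∈ G.blockEdges ω m σ ↔ ∃ i, InNontrivialBlock σ i ∧ e ∈ G.clusterEdges ω (m i) := by
  simp [blockEdges]

variable [DecidableEq E]

/-- If `σ ≤ Π(ω)` then `σ ≤ Π(ω')` for the restriction `ω'` of `ω` to the block edges of `σ`. -/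
lemma le_markedPartition_restrictTo_blockEdges (ω : Config E) {k : ℕ} (m : Fin k → V)
    {σ : Setoid (Fin k)} (h : σ ≤ G.markedPartition ω m) :
    σ ≤ G.markedPartition (restrictTo (G.blockEdges ω m σ) ω) m := by
  rw [Setoid.le_def] at h ⊢
  intro i j hij
  rw [G.markedPartition_rel]
  by_cases hne : j = i
  · subst hne
    exact Conn.refl G _ _
  · have hi : InNontrivialBlock σ i := ⟨j, hne, hij⟩
    have hconn : G.Conn ω (m i) (m j) := (G.markedPartition_rel ω m i j).1 (h hij)
    have hK : G.clusterEdges ω (m i) ⊆ G.blockEdges ω m σ :=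
      fun e he => (G.mem_blockEdges).2 ⟨i, hi, he⟩
    exact Conn.mono (restrictTo_mono hK ω) (G.conn_restrictTo_clusterEdges hconn)

/-- `F(σ₁, σ₂) ⊆ {σ₁ ≤ Π} ◻ {σ₂ ≤ Π}` (open-witness form): the witnesses are the block edges of
`σ₁` and of `σ₂`. -/
lemma bkEvent_subset_disjOccurRestrict {k : ℕ} (m : Fin k → V) (σ₁ σ₂ : Setoid (Fin k)) :
    G.bkEvent m σ₁ σ₂ ⊆
      disjOccurRestrict (G.partitionIn m (Set.Ici σ₁)) (G.partitionIn m (Set.Ici σ₂)) := by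
  rintro ω ⟨h1, h2, h3⟩
  refine ⟨G.blockEdges ω m σ₁, G.blockEdges ω m σ₂, ?_, ?_, ?_⟩
  · rw [Finset.disjoint_left]
    intro e he1 he2
    rw [G.mem_blockEdges] at he1 he2
    obtain ⟨i, hi, hei⟩ := he1
    obtain ⟨j, hj, hej⟩ := he2
    rw [G.mem_clusterEdges] at hei hej
    exact h3 i j hi hj (hei.2.trans hej.2.symm)
  · show σ₁ ≤ G.markedPartition (restrictTo (G.blockEdges ω m σ₁) ω) m
    exact G.le_markedPartition_restrictTo_blockEdges ω m h1
  · show σ₂ ≤ G.markedPartition (restrictTo (G.blockEdges ω m σ₂) ω) m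
    exact G.le_markedPartition_restrictTo_blockEdges ω m h2

/-- **(K2) BK in partition form** (PLAN.md §1): for partitions `σ₁`, `σ₂` of the marked vertices,
`P(Π ∈ F(σ₁, σ₂)) ≤ P(σ₁ ≤ Π) · P(σ₂ ≤ Π)`, from the BK inequality (`BKInequality E`). -/
theorem K2_partition_of_BK (hBK : BKInequality E) {p : E → ℝ} (hp : IsProb p) {k : ℕ}
    (m : Fin k → V) (σ₁ σ₂ : Setoid (Fin k)) :
    prob p (G.bkEvent m σ₁ σ₂) ≤
      prob p (G.partitionIn m (Set.Ici σ₁)) * prob p (G.partitionIn m (Set.Ici σ₂)) :=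
  (prob_mono hp (G.bkEvent_subset_disjOccurRestrict m σ₁ σ₂)).trans
    (BKInequality_iff_restrict.1 hBK p hp _ _ (G.isUpperSet_partitionIn m (isUpperSet_Ici σ₁))
      (G.isUpperSet_partitionIn m (isUpperSet_Ici σ₂)))

end BlockEdges

end MultiGraph

end PercRepro
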